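import Mathlib.Combinatorics.SimpleGraph.Clique
import Mathlib.LinearAlgebra.AffineSpace.AffineSubspace.Defs
import Mathlib.LinearAlgebra.Dimension.Finrank
import Mathlib.Analysis.SpecialFunctions.Pow.Real
import Mathlib.Analysis.SpecialFunctions.Log.Basic
import Mathlib.Analysis.Asymptotics.Defs
import Mathlib.Data.ZMod.Defs
import Mathlib.Data.Nat.Log
import Mathlib.Algebra.Polynomial.Eval.Degree
import Mathlib.Logic.Equiv.Defs
import Literature.Computability.Complexity.Classes
import Literature.Computability.Complexity.Nondeterministic
import Literature.Computability.Complexity.ProbabilisticClasses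
import Literature.Computability.Complexity.Circuit
import Literature.Computability.Complexity.CircuitClasses
import Literature.Computability.Complexity.ConstantDepth
import HarnessLib

-- provenance: harness21/H21/H21/Statements/PNP/CircuitLowerBounds.lean @ aa07551 (interim HEAD d8f2665); M5 mechanical rewrite
/-!
# Circuit lower bounds (family `pnp`, statements pnp.S20–pnp.S24; trunk CplxCore)

Five landmark Boolean circuit lower bounds (and one hardness-to-randomness consequence),
stated over the H21 straight-line circuit model `Literature.Computability.Complexity.Circuit`:

* **pnp.S20** `williams_acc` — `NTIME(2ⁿ) ⊄ ACC⁰` (Williams, J. ACM 2014, Thm. 1.1);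
* **pnp.S21** `hastad_parity` — depth-`k` unbounded fan-in circuits for `PARITYₙ` need size
  `2^{c_k n^{1/(k-1)}}` (Håstad 1986, Thm. 1; Furst–Saxe–Sipser 1984);
* **pnp.S22** `razborov_alon_boppana` — monotone circuits for `CLIQUE(m, ⌊¼ ln m⌋)` need
  `m^{C log m}` gates (Razborov 1985, Thm. 1; Alon–Boppana 1987, Thm. 3.9);
* **pnp.S23** `li_yang` — a `B₂`-circuit computing an affine disperser for sublinear dimension
  has at least `3.1 n - o(n)` gates (Li–Yang, STOC 2022, Thm. 1.1);
* **pnp.S24** `impagliazzo_wigderson` — if some language in `E` has circuit complexity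
  `2^{Ω(n)}` almost everywhere then `P = BPP` (Impagliazzo–Wigderson, STOC 1997, Thm. 2);
* `MurrayWilliams2018_NTIME_not_depth_ACC`, `MurrayWilliams2018_NQP_not_ACC` — the
  fine-grained lower bounds of Murray–Williams (STOC 2018, Thm. 1.3 and §1.1) for
  `NTIME[n^{log^e n}]` / `NQP` against depth-`d`, `n^{log^k n}`-size `AC⁰[m]` circuits (named
  facts, `def … : Prop`, threshold layer dropped), the headline consequence
  `MurrayWilliams2018_NQP_not_subset_ACC0 : ¬ (NQP ⊆ ACC0)` PROVED from the former
  (`MurrayWilliams2018_NQP_not_ACC.not_subset_ACC0`, via `natPoly_exists_eval_le_pow_log`), and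
  the class `Literature.CplxCore.NQP = ⋃ₖ NTIME(2^{(log₂ n)ᵏ})`.

## Design

* All circuit notions (`Circuit`, `IsOver`, `Computes`, `size`, `acDepth`, `acBasis`,
  `monotoneBasis`, `B2`, `circuitSizeOver`, `Language.circuitSize`, `parityFn`) and classes
  (`NTIME`, `ACC0`, `E`, `P`, `BPP`) come from the H21 CplxCore prelude; see those files for the
  conventions (negations are free in `acDepth`; `circuitSizeOver` is an `sInf` with junk value
  `0` when no circuit over the basis computes the function).
* `cliqueFn m s` takes an edge-indicator vector indexed by the edge set of the complete graph
  `⊤ : SimpleGraph (Fin m)` (i.e. by unordered pairs of distinct vertices, `m choose 2` inputs)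
  and decides whether the graph it spans (`SimpleGraph.fromEdgeSet`) contains an `s`-clique
  (`¬ CliqueFree s`). It is monotone and, for `2 ≤ s ≤ m`, non-constant, hence computed by a
  monotone circuit (an OR over all `s`-subsets of ANDs of their edges); so for large `m` the
  quantity `circuitSizeOver monotoneBasis (cliqueFn m ⌊ln m / 4⌋₊)` in pnp.S22 is a genuine
  minimum and not the junk value `0` (review F13c). We record this as the API lemmas
  `cliqueFn_monotone` and `exists_monotone_computes_cliqueFn`.
* Affine dispersers live on `𝔽₂ⁿ = Fin n → ZMod 2`, using Mathlib's `AffineSubspace` and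
  `Module.finrank` of its `direction`; the bridge to Boolean inputs is the equivalence
  `boolOfZMod2 : (Fin n → Bool) ≃ (Fin n → ZMod 2)` built from Mathlib's `finTwoEquiv`
  (`ZMod 2` is definitionally `Fin 2`). The `o(n)` terms of Li–Yang are phrased with Mathlib's
  `Asymptotics.IsLittleO` along `Filter.atTop` on `ℕ`, real-valued.
* Real exponents use `Real.rpow` (`(2:ℝ) ^ (c * n ^ (1/(k-1)))`, `(m:ℝ) ^ (C * Real.log m)`).
* Mathlib has no Boolean circuits, circuit classes, clique functions as Boolean functions, or
  dispersers (searched `Disperser`, `circuit`, `ACC`, `clique`); we use Mathlib's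
  `SimpleGraph.fromEdgeSet`, `SimpleGraph.CliqueFree`, `AffineSubspace`, `Module.finrank`,
  `finTwoEquiv`, `Asymptotics.IsLittleO`, `Real.log`, `Real.rpow`.

## References

* R. Williams, *Nonuniform ACC circuit lower bounds*, J. ACM 61 (2014), Thm. 1.1.
* J. Håstad, *Almost optimal lower bounds for small depth circuits*, STOC 1986, Thm. 1.
* A. A. Razborov, *Lower bounds on the monotone complexity of some Boolean functions*,
  Dokl. Akad. Nauk SSSR 281 (1985), Thm. 1; N. Alon, R. Boppana, *The monotone circuit
  complexity of Boolean functions*, Combinatorica 7 (1987), Thm. 3.9.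
* J. Li, T. Yang, *3.1n - o(n) circuit lower bounds for explicit functions*, STOC 2022, Thm. 1.1.
* R. Impagliazzo, A. Wigderson, *P = BPP if E requires exponential circuits*, STOC 1997, Thm. 2.
* C. D. Murray, R. R. Williams, *Circuit lower bounds for nondeterministic quasi-polytime: an easy
  witness lemma for NP and NQP*, STOC 2018, 890–901 (ECCC TR17-188), Thm. 1.3 and §1.1.
-/

namespace Literature.Computability.Complexity

open Classes Filter Asymptotics

/-! ### pnp.S20 — Williams: NEXP-type lower bound against ACC⁰ -/

/-- **pnp.S20** (Williams, J. ACM 2014, Thm. 1.1). `NTIME(2ⁿ)` does not have non-uniform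
polynomial-size `ACC⁰` circuits: `NTIME (2 ^ ·) ⊄ ACC0`. [cite: ACM2014, Thm. 1.1] -/
def williams_acc : Prop :=
  ¬ (NTIME (fun n => 2 ^ n) ⊆ ACC0)

/-! ### pnp.S21 — Håstad: parity requires exponential size in constant depth -/

/-- **pnp.S21** (Håstad 1986, Thm. 1; Furst–Saxe–Sipser 1984 for the superpolynomial bound).
For every depth `k ≥ 2` there is a constant `c > 0` such that for all large `n`, every
unbounded fan-in circuit over `acBasis = {¬, ∧ₖ, ∨ₖ}` of depth at most `k` (negations free,
`Circuit.acDepth`) computing `PARITYₙ` has size at least `2 ^ (c · n ^ (1/(k-1)))`. [cite: Hastad1986, Thm. 1] -/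
def hastad_parity : Prop :=
  ∀ (k : ℕ) (hk : 2 ≤ k),
    ∃ c : ℝ, 0 < c ∧ ∃ N : ℕ, ∀ n ≥ N, ∀ C : Circuit (Fin n), C.IsOver acBasis →
      C.acDepth ≤ k → C.Computes (parityFn n) →
        (2 : ℝ) ^ (c * (n : ℝ) ^ (1 / ((k : ℝ) - 1))) ≤ C.size

/-! ### pnp.S22 — Razborov / Alon–Boppana: monotone complexity of CLIQUE -/

open Classical in
/-- The clique function `CLIQUE(m, s)` as a Boolean function of the `m choose 2` edge
indicators: the input `x` is indexed by the edges of the complete graph on `Fin m` (unordered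
pairs of distinct vertices), and `cliqueFn m s x = true` iff the graph with edge set
`{e | x e = true}` contains a clique on `s` vertices (Razborov 1985; Alon–Boppana 1987, §3;
Arora–Barak 2009, §14.3). Implemented with `SimpleGraph.fromEdgeSet` and
`SimpleGraph.CliqueFree`; classical decidability makes it `noncomputable`. [cite: Razborov1985] -/
noncomputable def cliqueFn (m s : ℕ) (x : (⊤ : SimpleGraph (Fin m)).edgeSet → Bool) : Bool :=
  decide (¬ (SimpleGraph.fromEdgeSet
    {e : Sym2 (Fin m) | ∃ h : e ∈ (⊤ : SimpleGraph (Fin m)).edgeSet, x ⟨e, h⟩ = true}).CliqueFree s)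

/-- `cliqueFn m s` is a monotone Boolean function (adding edges preserves cliques)
(Alon–Boppana 1987, §3; Arora–Barak 2009, §14.3). [cite: AlonBoppana1987, §3] -/
def cliqueFn_monotone : Prop :=
  ∀ (m s : ℕ),
    Monotone (cliqueFn m s)

/-- For `2 ≤ s ≤ m` the clique function is monotone and non-constant, hence computed by a
circuit over `monotoneBasis = {∧₂, ∨₂}` (the OR over all `s`-subsets of the AND of their
edges); consequently `circuitSizeOver monotoneBasis (cliqueFn m s)` is a genuine minimum, not
the junk value `0` of an empty infimum (Alon–Boppana 1987, §3; review F13c). [cite: AlonBoppana1987, §3] -/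
def exists_monotone_computes_cliqueFn : Prop :=
  ∀ {m s : ℕ} (h2 : 2 ≤ s) (hs : s ≤ m),
    ∃ C : Circuit ((⊤ : SimpleGraph (Fin m)).edgeSet), C.IsOver monotoneBasis ∧
      C.Computes (cliqueFn m s)

/-- **pnp.S22** (Razborov 1985, Thm. 1; Alon–Boppana 1987, Thm. 3.9). Monotone circuits for
`CLIQUE(m, ⌊¼ ln m⌋)` need `m ^ (C log m)` gates: there is `C > 0` such that for all large `m`,
`m ^ (C · log m) ≤ circuitSizeOver monotoneBasis (cliqueFn m ⌊log m / 4⌋₊)`.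
Since `cliqueFn m s` is monotone and non-constant for `2 ≤ s ≤ m`
(`exists_monotone_computes_cliqueFn`), and `2 ≤ ⌊log m / 4⌋₊ ≤ m` for large `m`, the right-hand
side is not the junk value `0` eventually (review F13c). [cite: Razborov1985, Thm. 1] -/
def razborov_alon_boppana : Prop :=
  ∃ C : ℝ, 0 < C ∧ ∀ᶠ m : ℕ in atTop,
      (m : ℝ) ^ (C * Real.log m) ≤
        (circuitSizeOver monotoneBasis (cliqueFn m ⌊Real.log m / 4⌋₊) : ℝ)

/-! ### pnp.S23 — Li–Yang: `3.1 n - o(n)` for affine dispersers -/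

/-- `f : 𝔽₂ⁿ → {0,1}` is an *affine disperser for dimension `d`* if `f` is non-constant on
every affine subspace of `𝔽₂ⁿ = Fin n → ZMod 2` of dimension at least `d`
(Li–Yang STOC 2022, Def. in §1; Ben-Sasson–Kopparty 2012). Mathlib's `AffineSubspace`
includes the empty subspace (`⊥`), whence the nonemptiness hypothesis; the dimension is
`Module.finrank (ZMod 2) S.direction`. [cite: STOC2022, Def. in §1] -/
def IsAffineDisperser {n : ℕ} (f : (Fin n → ZMod 2) → Bool) (d : ℕ) : Prop :=
  ∀ S : AffineSubspace (ZMod 2) (Fin n → ZMod 2),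
    d ≤ Module.finrank (ZMod 2) S.direction → (S : Set (Fin n → ZMod 2)).Nonempty →
      ∃ x ∈ S, ∃ y ∈ S, f x ≠ f y

/-- The bridge between Boolean input vectors and vectors over `𝔽₂`: componentwise
`false ↦ 0`, `true ↦ 1` (the inverse of Mathlib's `finTwoEquiv : Fin 2 ≃ Bool`; `ZMod 2` is
definitionally `Fin 2`). Used to view a function on `𝔽₂ⁿ` as a Boolean function on
`Fin n → Bool` (Li–Yang STOC 2022, §2). [cite: STOC2022, §2] -/
def boolOfZMod2 {n : ℕ} : (Fin n → Bool) ≃ (Fin n → ZMod 2) :=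
  Equiv.piCongrRight fun _ => (finTwoEquiv.symm : Bool ≃ Fin 2)

/-- **pnp.S23** (Li–Yang, STOC 2022, Thm. 1.1). Every circuit over the full binary basis `B₂`
computing an affine disperser for sublinear dimension has at least `3.1 n - o(n)` gates: for
every dimension bound `d = o(n)` there is an error term `e = o(n)` such that for all `n` and
every affine disperser `f : 𝔽₂ⁿ → {0,1}` for dimension `d n`,
`3.1 n - e n ≤ circuitSizeOver B2 (f ∘ boolOfZMod2)`. [cite: STOC2022, Thm. 1.1] -/
def li_yang : Prop :=
  ∀ d : ℕ → ℕ, ((fun n => (d n : ℝ)) =o[atTop] fun n => (n : ℝ)) →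
      ∃ e : ℕ → ℝ, (e =o[atTop] fun n => (n : ℝ)) ∧
        ∀ (n : ℕ) (f : (Fin n → ZMod 2) → Bool), IsAffineDisperser f (d n) →
          3.1 * n - e n ≤ (circuitSizeOver B2 (f ∘ boolOfZMod2) : ℝ)

/-! ### pnp.S24 — Impagliazzo–Wigderson: hardness of E derandomises BPP -/

/-- **pnp.S24** (Impagliazzo–Wigderson, STOC 1997, Thm. 2). If some language `L ∈ E` has
circuit complexity `2^{Ω(n)}` almost everywhere — there is `ε > 0` with
`2 ^ (ε n) ≤ L.circuitSize n` for all large `n` — then `P = BPP`. [cite: STOC1997, Thm. 2] -/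
def impagliazzo_wigderson : Prop :=
  (∃ L ∈ E, ∃ ε : ℝ, 0 < ε ∧ ∀ᶠ n : ℕ in atTop, (2 : ℝ) ^ (ε * n) ≤ (L.circuitSize n : ℝ)) →
      P = BPP

end Literature.Computability.Complexity

/-! ### Murray–Williams 2018: nondeterministic quasi-polynomial time versus ACC⁰ -/

namespace Literature.Computability.Complexity

/-- The class `NQP = ⋃ₖ NTIME(2^{(log₂ n)ᵏ})` of languages decidable in nondeterministic
quasi-polynomial time (Murray–Williams, STOC 2018, §1: `NQP = NTIME[n^{log^{O(1)} n}]`; the two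
descriptions give the same union since `n ≤ 2 ^ (⌊log₂ n⌋ + 1)`). Arithmetic form with
`Nat.log 2` as in `NC` (`Nat.log 2 0 = Nat.log 2 1 = 0`); the summand `k = 0` is `NTIME 2` and
does not enlarge the union beyond constant time. [cite: MurrayWilliams2018, §1] -/
def NQP : Set (Language Bool) :=
  ⋃ k : ℕ, NTIME (fun n => 2 ^ (Nat.log 2 n) ^ k)

/-- Membership in `NQP`, unfolded (definitional). [folklore] -/
theorem mem_NQP_iff {L : Language Bool} :
    L ∈ NQP ↔ ∃ k : ℕ, L ∈ NTIME (fun n => 2 ^ (Nat.log 2 n) ^ k) := by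
  simp [NQP]

/-- Each level `NTIME(2^{(log₂ n)ᵏ})` is contained in `NQP`. [folklore] -/
theorem NTIME_quasipoly_subset_NQP (k : ℕ) :
    NTIME (fun n => 2 ^ (Nat.log 2 n) ^ k) ⊆ NQP :=
  Set.subset_iUnion (fun k : ℕ => NTIME (fun n => 2 ^ (Nat.log 2 n) ^ k)) k

end Literature.Computability.Complexity

namespace Literature.Computability.Complexity

open Classes

/-- (Murray–Williams, STOC 2018, Thm. 1.3, printed form minus the bottom threshold layer.)
"For every constant `k`, `d`, and `m ≥ 2`, there is an `e ≥ 1` and a problem in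
`NTIME[n^{log^e n}]` which does not have depth-`d` `n^{log^k n}`-size `AC[m]` circuits, even with
`n^{log^k n}` linear threshold gates at the bottom layer." Stated here for plain `AC⁰[m]`
circuits (basis `accBasis m`, depth `acDepth ≤ d`), which is the special case without threshold
gates and hence implied by the printed theorem; `log` is `Nat.log 2`. The size bound is taken
in the arithmetic `O`-form `c * n ^ (log₂ n) ^ k + c` for every `c` (the idiom of `NTIME`,
`NC`; `DepthSizeClass` imposes its bound at every length `n`, so the bare bound
`n ^ (log₂ n) ^ k` would collapse to `0`/`n` at `n ≤ 3` and make the class artificially small);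
since `NTIME[n^{log^e n}]` carries the same slack and `e` is existential, this is the printed
asymptotic statement. [cite: MurrayWilliams2018, Thm. 1.3] -/
def MurrayWilliams2018_NTIME_not_depth_ACC : Prop :=
  ∀ (k d m : ℕ), 2 ≤ m →
    ∃ e : ℕ, 1 ≤ e ∧ ∃ L ∈ NTIME (fun n => n ^ (Nat.log 2 n) ^ e),
      ∀ c : ℕ, L ∉ DepthSizeClass (accBasis m) (fun _ => d) (fun n => c * n ^ (Nat.log 2 n) ^ k + c)

/-- (Murray–Williams, STOC 2018, Abstract and §1.1: "for every fixed `k`, `NQP` does not have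
`n^{log^k n}`-size `ACC ∘ THR` circuits", "the separation `NQP ⊄ ACC ∘ THR`", derived there from
Thm. 1.3 via Thm. 1.2.) Threshold-free form: for every `k` there is a language in
`NQP = ⋃ₑ NTIME(2^{(log₂ n)^e})` which, for no depth `d`, modulus `m ≥ 2` and constant `c`, is
decided by `AC⁰[m]`-circuit families of depth `d` and size `c * n ^ (log₂ n) ^ k + c`
(arithmetic `O`-form, see `MurrayWilliams2018_NTIME_not_depth_ACC`). Dropping the bottom `THR`
layer weakens the printed statement. Strengthens `williams_acc` (`NTIME(2ⁿ) ⊄ ACC⁰`,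
Williams 2014); the polynomial-size consequence `¬ (NQP ⊆ ACC0)` is
`MurrayWilliams2018_NQP_not_ACC.not_subset_ACC0`. [cite: MurrayWilliams2018, §1.1 and Thm. 1.3] -/
def MurrayWilliams2018_NQP_not_ACC : Prop :=
  ∀ k : ℕ, ∃ L ∈ NQP, ∀ (d m c : ℕ), 2 ≤ m →
    L ∉ DepthSizeClass (accBasis m) (fun _ => d) (fun n => c * n ^ (Nat.log 2 n) ^ k + c)

/-- The coarse consequence recorded as a named statement: nondeterministic quasi-polynomial
time does not have polynomial-size `ACC⁰` circuit families, `¬ (NQP ⊆ ACC0)`, i.e.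
`¬ ((⋃ k, NTIME (fun n => 2 ^ (Nat.log 2 n) ^ k)) ⊆ ⋃ m ≥ 2, AC0Mod m)` (the signature requested
by routes `PneNP/circuit`, `PneNP/ktlang`). It follows from `MurrayWilliams2018_NQP_not_ACC`
(`MurrayWilliams2018_NQP_not_ACC.not_subset_ACC0`, proved below: every polynomial is
`≤ c * n ^ log₂ n + c`). [cite: MurrayWilliams2018, §1.1] -/
def MurrayWilliams2018_NQP_not_subset_ACC0 : Prop :=
  ¬ (NQP ⊆ ACC0)

/-- `MurrayWilliams2018_NQP_not_subset_ACC0` with `NQP` unfolded to the explicit union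
`⋃ k, NTIME (2 ^ (log₂ n) ^ k)` (the form requested by routes `PneNP/circuit`, `PneNP/ktlang`).
[folklore] -/
theorem MurrayWilliams2018_NQP_not_subset_ACC0_iff :
    MurrayWilliams2018_NQP_not_subset_ACC0 ↔
      ¬ ((⋃ k : ℕ, NTIME (fun n => 2 ^ (Nat.log 2 n) ^ k)) ⊆ ACC0) :=
  Iff.rfl

/-- Evaluation of a polynomial over `ℕ` is monotone in the argument. [folklore] -/
theorem natPoly_eval_mono (p : Polynomial ℕ) {x y : ℕ} (h : x ≤ y) : p.eval x ≤ p.eval y := by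
  rw [Polynomial.eval_eq_sum_range, Polynomial.eval_eq_sum_range]
  exact Finset.sum_le_sum fun i _ => Nat.mul_le_mul_left _ (Nat.pow_le_pow_left h i)

/-- For `1 ≤ n`, `p(n) ≤ p(1) · n ^ deg p` over `ℕ`. [folklore] -/
theorem natPoly_eval_le_eval_one_mul_pow (p : Polynomial ℕ) {n : ℕ} (hn : 1 ≤ n) :
    p.eval n ≤ p.eval 1 * n ^ p.natDegree := by
  rw [Polynomial.eval_eq_sum_range, Polynomial.eval_eq_sum_range, Finset.sum_mul]
  refine Finset.sum_le_sum fun i hi => ?_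
  rw [one_pow, mul_one]
  exact Nat.mul_le_mul_left _
    (Nat.pow_le_pow_right hn (Nat.lt_succ_iff.mp (Finset.mem_range.mp hi)))

/-- Every polynomial bound is eventually, indeed everywhere up to an additive constant, below the
quasi-polynomial `n ^ log₂ n`: `∃ c, ∀ n, p(n) ≤ c * n ^ (log₂ n) + c` (for `n ≥ 2 ^ deg p` one
has `deg p ≤ log₂ n`; smaller `n` are absorbed by `c`). [folklore] -/
theorem natPoly_exists_eval_le_pow_log (p : Polynomial ℕ) :
    ∃ c : ℕ, ∀ n : ℕ, p.eval n ≤ c * n ^ Nat.log 2 n + c := by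
  set D := p.natDegree
  refine ⟨p.eval 1 * (2 ^ D) ^ D + p.eval 1, fun n => ?_⟩
  rcases Nat.eq_zero_or_pos n with rfl | hn
  · have := natPoly_eval_mono p (Nat.zero_le 1)
    exact this.trans ((Nat.le_add_left _ _).trans (Nat.le_add_left _ _))
  have h1 := natPoly_eval_le_eval_one_mul_pow p hn
  by_cases hD : 2 ^ D ≤ n
  · have hlog : D ≤ Nat.log 2 n := (Nat.le_log_iff_pow_le one_lt_two hn.ne').mpr hD
    have h2 : n ^ D ≤ n ^ Nat.log 2 n := Nat.pow_le_pow_right hn hlog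
    calc p.eval n ≤ p.eval 1 * n ^ D := h1
      _ ≤ p.eval 1 * n ^ Nat.log 2 n := Nat.mul_le_mul_left _ h2
      _ ≤ (p.eval 1 * (2 ^ D) ^ D + p.eval 1) * n ^ Nat.log 2 n :=
          Nat.mul_le_mul_right _ (Nat.le_add_left _ _)
      _ ≤ _ := Nat.le_add_right _ _
  · have h3 : n ^ D ≤ (2 ^ D) ^ D := Nat.pow_le_pow_left (Nat.le_of_not_le hD) D
    calc p.eval n ≤ p.eval 1 * n ^ D := h1
      _ ≤ p.eval 1 * (2 ^ D) ^ D := Nat.mul_le_mul_left _ h3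
      _ ≤ p.eval 1 * (2 ^ D) ^ D + p.eval 1 := Nat.le_add_right _ _
      _ ≤ _ := Nat.le_add_left _ _

/-- **Corollary** (the headline `NQP ⊄ ACC⁰`): `MurrayWilliams2018_NQP_not_ACC` (at `k = 1`)
implies that `NQP` does not have polynomial-size `ACC⁰` circuit families, since every polynomial
size bound `p(n)` is `≤ c * n ^ log₂ n + c` (`natPoly_exists_eval_le_pow_log`) and
`DepthSizeClass` is monotone in the size bound. [cite: MurrayWilliams2018, §1.1] -/
theorem MurrayWilliams2018_NQP_not_ACC.not_subset_ACC0 (h : MurrayWilliams2018_NQP_not_ACC) :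
    MurrayWilliams2018_NQP_not_subset_ACC0 := by
  intro hsub
  obtain ⟨L, hL, hnot⟩ := h 1
  have hACC : L ∈ ACC0 := hsub hL
  simp only [ACC0, Set.mem_iUnion] at hACC
  obtain ⟨m, hm, hLm⟩ := hACC
  obtain ⟨d, p, hLp⟩ := hLm
  obtain ⟨c, hc⟩ := natPoly_exists_eval_le_pow_log p
  refine hnot d m c hm (DepthSizeClass_mono le_rfl (fun _ => le_rfl) (fun n => ?_) hLp)
  simpa only [pow_one] using hc n

/-- Corollary form: under `MurrayWilliams2018_NQP_not_subset_ACC0` there is a language in some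
level `NTIME(2^{(log₂ n)ᵏ})` lying in no `AC⁰[m]`, `m ≥ 2`. [folklore] -/
theorem MurrayWilliams2018_NQP_not_subset_ACC0.exists_not_mem_AC0Mod
    (h : MurrayWilliams2018_NQP_not_subset_ACC0) :
    ∃ k : ℕ, ∃ L ∈ NTIME (fun n => 2 ^ (Nat.log 2 n) ^ k), ∀ m : ℕ, 2 ≤ m → L ∉ AC0Mod m := by
  by_contra hcon
  push Not at hcon
  apply h
  intro L hL
  obtain ⟨k, hk⟩ := mem_NQP_iff.mp hL
  obtain ⟨m, hm, hLm⟩ := hcon k L hk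
  simp only [ACC0, Set.mem_iUnion]
  exact ⟨m, hm, hLm⟩

end Literature.Computability.Complexity
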